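import Mathlib.Analysis.Convex.Cone.Extension
import Mathlib.LinearAlgebra.Basis.VectorSpace
import Mathlib.Algebra.Order.Archimedean.Real.Basic
import HarnessLib

/-!
# Order-unit duality: the certified bounds of a cone with an order unit are exactly the bounds valid for every normalised positive functional (gauge-boot, L1/L4 supplement)

HONEST FRAMING (cell `pub-gaugeboot`, page 1 of every file): the venture produces certified bounds
on lattice expectations at stated coupling, gauge group, dimension and torus size; NOT a mass gap,
NOT a continuum limit, NOT a string tension; NOT Yang–Mills-summit-bearing (barriers
`FixedCouplingUltralocality`, `PerturbativeInvisibility`). Pure linear algebra; it certifies no number.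

## Content (the abstract duality behind "SOS ⊕ loop-equation certificates are complete")

Let `A` be a real vector space, `K ⊆ A` a convex cone (`PointedCone ℝ A`), `u ∈ K`, and `E ⊆ A` a
subspace containing `K` on which `u` is an ORDER UNIT: every `x ∈ E` has some `t` with
`t • u - x ∈ K` (the Archimedean property). A linear functional `φ : A →ₗ[ℝ] ℝ` is DUAL FEASIBLE
(`IsDualFeasible K u φ`) when `φ ≥ 0` on `K` and `φ u = 1`; assume one exists. For `x ∈ E` the
CERTIFIED LEVELS `certLevels K u x = {t | t • u - x ∈ K}` form an up-set, bounded below, and the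
GAUGE `gauge K u x = inf certLevels` is a sublinear functional on `E`.

* `IsDualFeasible.le_of_mem_certLevels` — SOUNDNESS: a certificate `t • u - x ∈ K` bounds every
  dual-feasible functional, `φ x ≤ t`.
* ★★ `exists_isDualFeasible_apply_eq_gauge` — the supremum of `φ x` over dual-feasible `φ` is
  ATTAINED and equals the gauge (M. Riesz / Hahn–Banach extension `exists_extension_of_le_sublinear`
  of `c • x ↦ c · gauge x` dominated by the gauge, then `LinearMap.exists_extend` from `E` to `A`).
* ★★★ `forall_apply_le_iff` — COMPLETENESS / no duality gap: for `x ∈ E`,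
  `(∀ φ dual feasible, φ x ≤ c) ↔ ∀ ε > 0, (c + ε) • u - x ∈ K`; `isGreatest_gauge`,
  `sSup_eq_sInf` (`max {φ x} = inf {t | t • u - x ∈ K}`), and the lower-bound twin
  `forall_le_apply_iff`.

No topology and no finite-dimensionality are used. The instance of interest
(`BootstrapCertificates.lean` and sequels): `A` = observables, `K` = squares of test functions of
word length `≤ n` plus the linear span of the level-`n` Schwinger–Dyson row elements, `u = 1`,
`E` = words of length `≤ 2n` plus rows (order unit by unitarity of the link variables); the dual
feasible functionals are exactly the level-`n` bootstrap-feasible functionals.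

References: C. Josz, D. Henrion, Optim. Lett. 10 (2016) 3–10 (arXiv:1405.7334: no duality gap in
Lasserre's hierarchy once a ball constraint makes the quadratic module Archimedean); M. Laurent,
in IMA Vol. Math. Appl. 149 (2009), Thm 6.1; M. Riesz extension (Mathlib `riesz_extension`). Folklore.
-/

noncomputable section

namespace Summit.QuantumFields.GaugeBoot

namespace OrderUnitDuality

variable {A : Type*} [AddCommGroup A] [Module ℝ A]

/-- **Dual feasibility**: `φ` is non-negative on the cone `K` and normalised at `u`. [shape] A
parametric definition of a proposition — NOT a fact. [folklore] -/
def IsDualFeasible (K : PointedCone ℝ A) (u : A) (φ : A →ₗ[ℝ] ℝ) : Prop :=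
  (∀ x ∈ K, 0 ≤ φ x) ∧ φ u = 1

/-- **Certified levels** of `x`: the `t` with `t • u - x ∈ K` (a "certificate" that `x ≤ t`).
[folklore] -/
def certLevels (K : PointedCone ℝ A) (u x : A) : Set ℝ :=
  {t : ℝ | t • u - x ∈ K}

/-- **The order-unit gauge** `inf {t | t • u - x ∈ K}` (junk `0` when no level is certified).
[folklore] -/
def gauge (K : PointedCone ℝ A) (u x : A) : ℝ :=
  sInf (certLevels K u x)

variable {K : PointedCone ℝ A} {u : A}

/-- Membership in `certLevels`, unfolded. -/
theorem mem_certLevels {t : ℝ} {x : A} : t ∈ certLevels K u x ↔ t • u - x ∈ K :=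
  Iff.rfl

/-- Non-negative real multiples stay in a pointed cone. -/
theorem smul_mem_of_nonneg {c : ℝ} (hc : 0 ≤ c) {x : A} (hx : x ∈ K) : c • x ∈ K :=
  PointedCone.smul_mem K hc hx

/-- The certified levels form an up-set (`u ∈ K`). -/
theorem certLevels_mono (hu : u ∈ K) {x : A} {s t : ℝ} (hs : s ∈ certLevels K u x) (hst : s ≤ t) :
    t ∈ certLevels K u x := by
  have h : t • u - x = (s • u - x) + (t - s) • u := by
    rw [sub_smul]; abel
  rw [mem_certLevels, h]
  exact K.add_mem hs (smul_mem_of_nonneg (sub_nonneg.2 hst) hu)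

/-- ★ **Soundness of certificates**: `t • u - x ∈ K` gives `φ x ≤ t` for every dual-feasible `φ`.
[folklore] -/
theorem IsDualFeasible.le_of_mem_certLevels {φ : A →ₗ[ℝ] ℝ} (hφ : IsDualFeasible K u φ) {x : A}
    {t : ℝ} (ht : t ∈ certLevels K u x) : φ x ≤ t := by
  have h := hφ.1 _ ht
  rw [map_sub, map_smul, hφ.2, smul_eq_mul, mul_one] at h
  linarith

/-- Lower-bound certificates are sound: `x - t • u ∈ K` gives `t ≤ φ x`. [folklore] -/
theorem IsDualFeasible.le_apply_of_sub_smul_mem {φ : A →ₗ[ℝ] ℝ} (hφ : IsDualFeasible K u φ)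
    {x : A} {t : ℝ} (ht : x - t • u ∈ K) : t ≤ φ x := by
  have h := hφ.1 _ ht
  rw [map_sub, map_smul, hφ.2, smul_eq_mul, mul_one] at h
  linarith

/-- A dual-feasible functional vanishes at `0` and bounds the certified levels from below. -/
theorem certLevels_bddBelow (h0 : ∃ φ, IsDualFeasible K u φ) (x : A) :
    BddBelow (certLevels K u x) := by
  obtain ⟨φ, hφ⟩ := h0
  exact ⟨φ x, fun t ht => hφ.le_of_mem_certLevels ht⟩

/-- The gauge is below every certified level. -/
theorem gauge_le (h0 : ∃ φ, IsDualFeasible K u φ) {x : A} {t : ℝ} (ht : t ∈ certLevels K u x) :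
    gauge K u x ≤ t :=
  csInf_le (certLevels_bddBelow h0 x) ht

/-- Every dual-feasible functional is below the gauge (when some level is certified). -/
theorem IsDualFeasible.apply_le_gauge {φ : A →ₗ[ℝ] ℝ} (hφ : IsDualFeasible K u φ) {x : A}
    (hx : (certLevels K u x).Nonempty) : φ x ≤ gauge K u x :=
  le_csInf hx fun _ ht => hφ.le_of_mem_certLevels ht

/-- Every level strictly above the gauge is certified. -/
theorem mem_certLevels_of_gauge_lt (hu : u ∈ K) {x : A} (hx : (certLevels K u x).Nonempty)
    {t : ℝ} (h : gauge K u x < t) : t ∈ certLevels K u x := by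
  obtain ⟨s, hs, hst⟩ := exists_lt_of_csInf_lt hx h
  exact certLevels_mono hu hs hst.le

/-- The gauge of `0` is `0`. -/
theorem gauge_zero (h0 : ∃ φ, IsDualFeasible K u φ) : gauge K u (0 : A) = 0 := by
  have hmem : (0 : ℝ) ∈ certLevels K u (0 : A) := by
    rw [mem_certLevels, zero_smul, sub_zero]; exact K.zero_mem
  refine le_antisymm (gauge_le h0 hmem) (le_csInf ⟨0, hmem⟩ fun t ht => ?_)
  obtain ⟨φ, hφ⟩ := h0
  have h := hφ.le_of_mem_certLevels ht
  rwa [map_zero] at h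

/-- Subadditivity of the gauge. -/
theorem gauge_add_le (hu : u ∈ K) (h0 : ∃ φ, IsDualFeasible K u φ) {x y : A}
    (hx : (certLevels K u x).Nonempty) (hy : (certLevels K u y).Nonempty) :
    gauge K u (x + y) ≤ gauge K u x + gauge K u y := by
  refine le_of_forall_pos_le_add fun ε hε => ?_
  have h1 := mem_certLevels_of_gauge_lt hu hx (lt_add_of_pos_right (gauge K u x) (half_pos hε))
  have h2 := mem_certLevels_of_gauge_lt hu hy (lt_add_of_pos_right (gauge K u y) (half_pos hε))
  have h12 : (gauge K u x + ε / 2) + (gauge K u y + ε / 2) ∈ certLevels K u (x + y) := by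
    rw [mem_certLevels] at h1 h2 ⊢
    have h : ((gauge K u x + ε / 2) + (gauge K u y + ε / 2)) • u - (x + y) =
        ((gauge K u x + ε / 2) • u - x) + ((gauge K u y + ε / 2) • u - y) := by
      rw [add_smul]; abel
    rw [h]
    exact K.add_mem h1 h2
  have h3 := gauge_le h0 h12
  linarith

/-- Positive homogeneity of the gauge, the inequality. -/
theorem gauge_smul_le (hu : u ∈ K) (h0 : ∃ φ, IsDualFeasible K u φ) {x : A}
    (hx : (certLevels K u x).Nonempty) {c : ℝ} (hc : 0 < c) :
    gauge K u (c • x) ≤ c * gauge K u x := by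
  refine le_of_forall_pos_le_add fun ε hε => ?_
  have h1 := mem_certLevels_of_gauge_lt hu hx (lt_add_of_pos_right (gauge K u x) (div_pos hε hc))
  have h2 : c * (gauge K u x + ε / c) ∈ certLevels K u (c • x) := by
    rw [mem_certLevels] at h1 ⊢
    have h : (c * (gauge K u x + ε / c)) • u - c • x = c • ((gauge K u x + ε / c) • u - x) := by
      rw [smul_sub, smul_smul]
    rw [h]
    exact smul_mem_of_nonneg hc.le h1
  have h3 := gauge_le h0 h2
  have h4 : c * (gauge K u x + ε / c) = c * gauge K u x + ε := by
    field_simp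
  linarith

/-- Positive homogeneity of the gauge. -/
theorem gauge_smul (hu : u ∈ K) (h0 : ∃ φ, IsDualFeasible K u φ) {x : A}
    (hx : (certLevels K u x).Nonempty) (hcx : ∀ c : ℝ, 0 < c → (certLevels K u (c • x)).Nonempty)
    {c : ℝ} (hc : 0 < c) : gauge K u (c • x) = c * gauge K u x := by
  refine le_antisymm (gauge_smul_le hu h0 hx hc) ?_
  have h := gauge_smul_le hu h0 (hcx c hc) (inv_pos.2 hc)
  rw [inv_smul_smul₀ hc.ne'] at h
  calc c * gauge K u x ≤ c * (c⁻¹ * gauge K u (c • x)) := mul_le_mul_of_nonneg_left h hc.le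
    _ = gauge K u (c • x) := by rw [← mul_assoc, mul_inv_cancel₀ hc.ne', one_mul]

/-- `gauge (-x) ≥ - gauge x`. -/
theorem neg_gauge_le_gauge_neg (hu : u ∈ K) (h0 : ∃ φ, IsDualFeasible K u φ) {x : A}
    (hx : (certLevels K u x).Nonempty) (hnx : (certLevels K u (-x)).Nonempty) :
    -gauge K u x ≤ gauge K u (-x) := by
  have h := gauge_add_le hu h0 hx hnx
  rw [add_neg_cancel, gauge_zero h0] at h
  linarith

/-! ## The main theorems: attained supremum, no duality gap -/

section Main

variable (E : Submodule ℝ A)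

/-- ★★ **The supremum of a linear objective over the dual-feasible functionals is attained, at the
gauge.** `E` a subspace containing `K` on which `u` is an order unit, a dual-feasible functional
exists, `P ∈ E`: some dual-feasible `φ` has `φ P = gauge K u P = inf {t | t • u - P ∈ K}`
(Riesz extension; no topology). [folklore] -/
theorem exists_isDualFeasible_apply_eq_gauge (hKE : ∀ x ∈ K, x ∈ E) (hu : u ∈ K)
    (hE : ∀ x ∈ E, ∃ t : ℝ, t • u - x ∈ K) (h0 : ∃ φ, IsDualFeasible K u φ) {P : A} (hP : P ∈ E) :
    ∃ φ : A →ₗ[ℝ] ℝ, IsDualFeasible K u φ ∧ φ P = gauge K u P := by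
  classical
  have hne : ∀ x : E, (certLevels K u (x : A)).Nonempty := fun x => hE x x.2
  -- the gauge as a sublinear functional on `E`
  let N : E → ℝ := fun x => gauge K u (x : A)
  have hN_hom : ∀ c : ℝ, 0 < c → ∀ x : E, N (c • x) = c * N x := fun c hc x => by
    show gauge K u ((c • x : E) : A) = c * gauge K u (x : A)
    rw [Submodule.coe_smul]
    exact gauge_smul hu h0 (hne x) (fun c' _ => by
      simpa only [Submodule.coe_smul] using hne (c' • x)) hc
  have hN_add : ∀ x y : E, N (x + y) ≤ N x + N y := fun x y => by
    show gauge K u ((x + y : E) : A) ≤ gauge K u (x : A) + gauge K u (y : A)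
    rw [Submodule.coe_add]
    exact gauge_add_le hu h0 (hne x) (hne y)
  -- non-negativity on `K` and normalisation follow from domination by the gauge
  have hdom : ∀ g : E →ₗ[ℝ] ℝ, (∀ x : E, g x ≤ N x) →
      ∀ φ : A →ₗ[ℝ] ℝ, φ.comp E.subtype = g → IsDualFeasible K u φ := by
    intro g hg φ hφ
    have hφE : ∀ x : E, φ (x : A) = g x := fun x => by
      rw [← hφ]; rfl
    refine ⟨fun x hx => ?_, ?_⟩
    · have h1 := hg (-⟨x, hKE x hx⟩)
      have h2 : N (-⟨x, hKE x hx⟩) ≤ 0 := by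
        refine gauge_le h0 ?_
        rw [mem_certLevels, zero_smul, zero_sub, Submodule.coe_neg, neg_neg]
        exact hx
      rw [map_neg, ← hφE] at h1
      have : φ x = φ ((⟨x, hKE x hx⟩ : E) : A) := rfl
      linarith
    · have h1 := hg ⟨u, hKE u hu⟩
      have h2 : N ⟨u, hKE u hu⟩ ≤ 1 := by
        refine gauge_le h0 ?_
        rw [mem_certLevels, one_smul]
        simp only [sub_self]
        exact K.zero_mem
      have h3 := hg (-⟨u, hKE u hu⟩)
      have h4 : N (-⟨u, hKE u hu⟩) ≤ -1 := by
        refine gauge_le h0 ?_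
        rw [mem_certLevels, Submodule.coe_neg, neg_smul, one_smul, sub_neg_eq_add, neg_add_cancel]
        exact K.zero_mem
      rw [map_neg, ← hφE] at h3
      rw [← hφE] at h1
      have : φ u = φ ((⟨u, hKE u hu⟩ : E) : A) := rfl
      linarith
  by_cases hP0 : P = 0
  · -- the objective is `0`: any extension of the zero functional dominated by `N` will do
    obtain ⟨g, -, hg⟩ := exists_extension_of_le_sublinear (⊥ : E →ₗ.[ℝ] ℝ) N hN_hom hN_add
      (fun z => by
        have hz : (z : E) = 0 := (Submodule.mem_bot ℝ).1 z.2
        have : ((⊥ : E →ₗ.[ℝ] ℝ) z) = 0 := rfl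
        rw [this]
        show 0 ≤ gauge K u ((z : E) : A)
        rw [hz, Submodule.coe_zero, gauge_zero h0])
    obtain ⟨φ, hφ⟩ := LinearMap.exists_extend g
    exact ⟨φ, hdom g hg φ hφ, by rw [hP0, map_zero, gauge_zero h0]⟩
  · have hP0' : (⟨P, hP⟩ : E) ≠ 0 := fun h => hP0 (by simpa using congrArg Subtype.val h)
    let f : E →ₗ.[ℝ] ℝ := LinearPMap.mkSpanSingleton (⟨P, hP⟩ : E) (gauge K u P) hP0'
    have hf : ∀ z : f.domain, f z ≤ N z := by
      intro z
      have hz : (z : E) ∈ (ℝ ∙ (⟨P, hP⟩ : E)) := by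
        simpa only [f, LinearPMap.domain_mkSpanSingleton] using z.2
      obtain ⟨c, hc⟩ := Submodule.mem_span_singleton.1 hz
      have hmem : c • (⟨P, hP⟩ : E) ∈ f.domain := by rw [hc]; exact z.2
      have hz' : z = ⟨c • ⟨P, hP⟩, hmem⟩ := Subtype.ext hc.symm
      have hfz : f ⟨c • ⟨P, hP⟩, hmem⟩ = c * gauge K u P := by
        simp only [f, LinearPMap.mkSpanSingleton, LinearPMap.mkSpanSingleton'_apply,
          RingHom.id_apply, smul_eq_mul]
      rw [hz', hfz]
      show c * gauge K u P ≤ gauge K u ((c • (⟨P, hP⟩ : E) : E) : A)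
      rw [Submodule.coe_smul]
      change c * gauge K u P ≤ gauge K u (c • P)
      rcases lt_trichotomy c 0 with hc0 | rfl | hc0
      · -- `c < 0`: `c • P = (-c) • (-P)` and `-gauge P ≤ gauge (-P)`
        have hnP : -P ∈ E := E.neg_mem hP
        have h1 : gauge K u ((-c) • (-P)) = (-c) * gauge K u (-P) :=
          gauge_smul hu h0 (hE _ hnP) (fun c' _ => hE _ (E.smul_mem c' hnP)) (neg_pos.2 hc0)
        have h2 := neg_gauge_le_gauge_neg hu h0 (hE P hP) (hE _ hnP)
        rw [show c • P = (-c) • (-P) by rw [smul_neg, neg_smul, neg_neg], h1]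
        nlinarith
      · rw [zero_smul, zero_mul, gauge_zero h0]
      · rw [gauge_smul hu h0 (hE P hP) (fun c' _ => hE _ (E.smul_mem c' hP)) hc0]
    obtain ⟨g, hgf, hg⟩ := exists_extension_of_le_sublinear f N hN_hom hN_add hf
    obtain ⟨φ, hφ⟩ := LinearMap.exists_extend g
    refine ⟨φ, hdom g hg φ hφ, ?_⟩
    have hPd : (⟨P, hP⟩ : E) ∈ f.domain := by
      rw [LinearPMap.domain_mkSpanSingleton]; exact Submodule.mem_span_singleton_self _
    have h1 : g ⟨P, hP⟩ = f ⟨⟨P, hP⟩, hPd⟩ := hgf ⟨⟨P, hP⟩, hPd⟩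
    have h2 : f ⟨⟨P, hP⟩, hPd⟩ = gauge K u P :=
      LinearPMap.mkSpanSingleton_apply ℝ ℝ hP0' (gauge K u P)
    have h3 : φ P = g ⟨P, hP⟩ := by rw [← hφ]; rfl
    rw [h3, h1, h2]

/-- ★★★ **No duality gap / completeness of certificates.** `K` a cone, `u ∈ K` an order unit on
the subspace `E ⊇ K`, a dual-feasible functional exists, `P ∈ E`: the bound `φ P ≤ c` holds for
EVERY dual-feasible `φ` if and only if `(c + ε) • u - P ∈ K` for every `ε > 0` — every valid bound
is certified to arbitrary precision. [folklore] -/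
theorem forall_apply_le_iff (hKE : ∀ x ∈ K, x ∈ E) (hu : u ∈ K)
    (hE : ∀ x ∈ E, ∃ t : ℝ, t • u - x ∈ K) (h0 : ∃ φ, IsDualFeasible K u φ) {P : A} (hP : P ∈ E)
    {c : ℝ} :
    (∀ φ : A →ₗ[ℝ] ℝ, IsDualFeasible K u φ → φ P ≤ c) ↔ ∀ ε : ℝ, 0 < ε → (c + ε) • u - P ∈ K := by
  constructor
  · intro h ε hε
    obtain ⟨φ, hφ, hφP⟩ := exists_isDualFeasible_apply_eq_gauge E hKE hu hE h0 hP
    have hg : gauge K u P ≤ c := hφP ▸ h φ hφ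
    exact mem_certLevels_of_gauge_lt hu (hE P hP) (by linarith)
  · intro h φ hφ
    exact le_of_forall_pos_le_add fun ε hε => hφ.le_of_mem_certLevels (h ε hε)

/-- **A strictly larger constant is certified exactly**: if `φ P ≤ c` for every dual-feasible `φ`
and `c < c'` then `c' • u - P ∈ K`. [folklore] -/
theorem sub_mem_of_forall_apply_le (hKE : ∀ x ∈ K, x ∈ E) (hu : u ∈ K)
    (hE : ∀ x ∈ E, ∃ t : ℝ, t • u - x ∈ K) (h0 : ∃ φ, IsDualFeasible K u φ) {P : A} (hP : P ∈ E)
    {c c' : ℝ} (h : ∀ φ : A →ₗ[ℝ] ℝ, IsDualFeasible K u φ → φ P ≤ c) (hc : c < c') :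
    c' • u - P ∈ K := by
  have h' := (forall_apply_le_iff E hKE hu hE h0 hP).1 h (c' - c) (sub_pos.2 hc)
  rwa [add_sub_cancel] at h'

/-- ★★★ **Lower bounds, dually**: `c ≤ φ P` for every dual-feasible `φ` iff `P - (c - ε) • u ∈ K`
for every `ε > 0`. [folklore] -/
theorem forall_le_apply_iff (hKE : ∀ x ∈ K, x ∈ E) (hu : u ∈ K)
    (hE : ∀ x ∈ E, ∃ t : ℝ, t • u - x ∈ K) (h0 : ∃ φ, IsDualFeasible K u φ) {P : A} (hP : P ∈ E)
    {c : ℝ} :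
    (∀ φ : A →ₗ[ℝ] ℝ, IsDualFeasible K u φ → c ≤ φ P) ↔ ∀ ε : ℝ, 0 < ε → P - (c - ε) • u ∈ K := by
  have h := forall_apply_le_iff E hKE hu hE h0 (E.neg_mem hP) (c := -c)
  have e1 : ∀ ε : ℝ, (-c + ε) • u - -P = P - (c - ε) • u := fun ε => by
    rw [sub_neg_eq_add, show -c + ε = -(c - ε) by ring, neg_smul]; abel
  simp only [map_neg, neg_le_neg_iff, e1] at h
  exact h

/-- ★★ **The maximum is the gauge**: `gauge K u P` is the greatest value of `P` over the
dual-feasible functionals. [folklore] -/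
theorem isGreatest_gauge (hKE : ∀ x ∈ K, x ∈ E) (hu : u ∈ K)
    (hE : ∀ x ∈ E, ∃ t : ℝ, t • u - x ∈ K) (h0 : ∃ φ, IsDualFeasible K u φ) {P : A} (hP : P ∈ E) :
    IsGreatest {t : ℝ | ∃ φ : A →ₗ[ℝ] ℝ, IsDualFeasible K u φ ∧ φ P = t} (gauge K u P) := by
  refine ⟨exists_isDualFeasible_apply_eq_gauge E hKE hu hE h0 hP, ?_⟩
  rintro t ⟨φ, hφ, rfl⟩
  exact hφ.apply_le_gauge (hE P hP)

/-- ★★ **No duality gap, as an equation**: `max {φ P | φ dual feasible} = inf {t | t • u - P ∈ K}`.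
[folklore] -/
theorem sSup_eq_sInf (hKE : ∀ x ∈ K, x ∈ E) (hu : u ∈ K)
    (hE : ∀ x ∈ E, ∃ t : ℝ, t • u - x ∈ K) (h0 : ∃ φ, IsDualFeasible K u φ) {P : A} (hP : P ∈ E) :
    sSup {t : ℝ | ∃ φ : A →ₗ[ℝ] ℝ, IsDualFeasible K u φ ∧ φ P = t} = sInf {t : ℝ | t • u - P ∈ K} :=
  (isGreatest_gauge E hKE hu hE h0 hP).csSup_eq

/-- **The certified levels are the ray above the maximum**: `(max, ∞) ⊆ certLevels ⊆ [max, ∞)`.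
[folklore] -/
theorem Ioi_subset_certLevels (hu : u ∈ K) (hE : ∀ x ∈ E, ∃ t : ℝ, t • u - x ∈ K)
    (h0 : ∃ φ, IsDualFeasible K u φ) {P : A} (hP : P ∈ E) :
    Set.Ioi (gauge K u P) ⊆ certLevels K u P ∧ certLevels K u P ⊆ Set.Ici (gauge K u P) :=
  ⟨fun _ ht => mem_certLevels_of_gauge_lt hu (hE P hP) ht, fun _ ht => gauge_le h0 ht⟩

end Main

end OrderUnitDuality

end Summit.QuantumFields.GaugeBoot

end
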